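import Literature.RepresentationTheory.ClassicalInvariants.TwoByTwoTupleSemiInvariants
import Literature.NumberTheory.DiophantineGeometry.KroneckerTriplePoly
import Literature.Computability.AlgebraicComplexity.MS08SeparabilityProofs
import Mathlib.LinearAlgebra.Matrix.Transvection
import HarnessLib

/-!
# BLMW 2011 Prop. 8.1 — the Kronecker coefficients `g((δ,δ),(δ,δ),π)` — PROVED,
# and with it Mulmuley–Sohoni GCT II Prop. 12.5

Sibling proofs file (D-0014: theorems and plumbing definitions only; no statement of the tree is
changed, no named fact is introduced) discharging TWO named facts of the cell `val-lit`:

* `BLMW2011_prop_8_1_holds : BLMW2011_prop_8_1` (`BLMW11KroneckerApproximation.lean`; Bürgisser–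
  Landsberg–Manivel–Weyman, SIAM J. Comput. 40 (2011) §8.3 "Prop. 8.1", quoting L. Manivel, *A note on
  certain Kronecker coefficients*, Proc. AMS 138 (2010) = arXiv:0809.3710, the case `n = 2`):
  `g((δ,δ),(δ,δ),π) ≠ 0` iff `π ⊢ 2δ` is even (all parts even) of length `≤ 4` or odd (all parts odd)
  of length exactly `4`, and then `g = 1`;
* `MS08_prop_12_5_holds : MS08_prop_12_5` (`MS08SecondFundamentalTheorem.lean`; Mulmuley–Sohoni,
  SIAM J. Comput. 38 (2008) Prop. 12.5, symmetric-group form), through the tree's reduction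
  `MS08_prop_12_5_of_BLMW2011_prop_8_1` (`MS08SeparabilityProofs.lean`).

## Proof of Prop. 8.1 (ours in execution; Manivel computes the algebra of `U`-invariants
`⊕_π (S_π(ℂ²⊗ℂ²⊗ℂ⁴))^{SL₂×SL₂×U₄}` and finds it polynomial on generators of weights
`(2), (2,2), (2,2,2), (1,1,1,1)` — we prove exactly the three consequences the statement needs)

1. **The model** (§2–§3). By the tree's dictionary (`KroneckerTriplePoly`: `finrank_symTripleHw`,
   `triplePoly`, `legSubstᵢ`), for `ℓ(π) ≤ 4`, `g((δ,δ),(δ,δ),π)` is the dimension of the space of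
   symmetric triple tensors `M ∈ (HW_{(δ,δ)} ⊗ HW_{(δ,δ)} ⊗ HW_π)^{S_{2δ}}` in `((k⁴)^{⊗2δ})^{⊗3}`, and
   `M ↦ P_M ∈ k[X_{((l,i),j)} : l, i, j < 4]` is injective and intertwines the three leg actions with
   linear substitutions. Since the first two weights are `(δ,δ,0,0)`, `P_M` only involves the letters
   `l, i < 2` (`letters_lt_two`, `rename_ι_κ_triplePoly`): it is a polynomial `Q_M = κ P_M` on 4-tuples
   of `2 × 2` matrices (the variables `Idx` of `TwoByTwoTupleSemiInvariants`). Highest weight vectors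
   give: `Q_M` is fixed by the column shears `x_b ↦ x_b + t x_a`, `a < b` (`shear₃_κ`), is
   multihomogeneous of multidegree `π` (`κ_mem_colWt`, contents of weight vectors), and its two
   `2 × (2·4)` readings are fixed by the row shear and bihomogeneous of bidegree `(δ, δ)`; by
   `TwoRowSl2.rowSubst_eq_self_of_shear` (a `U₂`-fixed form of bidegree `(δ,δ)` is `SL₂`-fixed) `Q_M`
   is fixed by `x_j ↦ g x_j` and `x_j ↦ x_j g`, `g ∈ SL₂` (`subst₁_κ`, `subst₂_κ`).
2. **Vanishing and multiplicity** (§4–§5). Theorem A of `TwoByTwoTupleSemiInvariants`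
   (`parity_of_ne_zero`: sign flips in `SO₄ = SL₂ × SL₂`) gives `π₀ ≡ π₁ ≡ π₂ ≡ π₃ (mod 2)` whenever some
   `M ≠ 0`, and Theorem B (`exists_smul_eq_of_semiInvariant`: the generic tuple is one orbit up to
   column scalings) gives `dim ≤ 1`. The length bound `ℓ(π) ≤ 4` is the tree's IMW point-set bound
   (`exists_pointSet_rows_of_kroneckerCoeff_pos`: a positive coefficient yields a `2δ`-point SET in
   `ℕ³` with marginals `((δ,δ),(δ,δ),πᵀ)`; its points have `x, y < 2`, so `ℓ(π) = πᵀ₁ = #{z = 0} ≤ 4`).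
3. **Existence** (§6). The five atoms `((m,m),(m,m),(2^m))`, `m ≤ 4`, and `((2,2),(2,2),(1,1,1,1))`
   are positive (kernel-certified by the tree's Murnaghan–Nakayama evaluator `MNEval.kronSum`), and
   every admissible `π` is a row-wise sum of atoms: induction on `δ`, peeling `(2^{ℓ(π)})` (even case)
   or `(1,1,1,1)` (odd case), with the semigroup property (`kroneckerCoeff_pos_of_getD_add`, after
   Christandl–Harrow–Mitchison / Ikenmeyer–Panova §1.1).

Statements in §2–§5 are over any algebraically closed field of characteristic zero (the vanishing
half needs square roots only through `TwoByTwoTupleSemiInvariants`); §6–§8 are over `ℂ` as the facts.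
Honest framing: two R1 literature facts of the cell's FACT-LIST are now theorems; `VP ≠ VNP` is NOT
proved and nothing here is progress on it.

## References

* [BurgisserEtAl2011] P. Bürgisser, J. M. Landsberg, L. Manivel, J. Weyman, *An overview of
  mathematical issues arising in the geometric complexity theory approach to VP ≠ VNP*, SIAM J.
  Comput. 40 (2011) 1179–1209, §8.3 Prop. 8.1 (held text p. 22).
* L. Manivel, *A note on certain Kronecker coefficients*, Proc. Amer. Math. Soc. 138 (2010) 1–7
  (arXiv:0809.3710), the case `n = 2`.
* [MulmuleySohoniGCT2SIAM2008] K. Mulmuley, M. Sohoni, *Geometric complexity theory II*, SIAM J.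
  Comput. 38 (2008), Prop. 12.5.
* [IkenmeyerMulmuleyWalter2017] C. Ikenmeyer, K. Mulmuley, M. Walter, *On vanishing of Kronecker
  coefficients*, comput. complexity 26 (2017), Lemma 2.3 (point sets).
* [IkenmeyerPanova2017] C. Ikenmeyer, G. Panova, Adv. Math. 319 (2017), §1.1 (semigroup property).
* [FultonHarrisGTM129] W. Fulton, J. Harris, GTM 129, §15.1, §15.3 (Borel subgroup, weight vectors).

## Tree / Mathlib

Tree: `TwoByTwoTupleSemiInvariants` (Theorems A, B), `TwoRowSl2Invariance`
(`rowSubst_eq_self_of_shear`), `KroneckerTriplePoly` (`triplePoly`, `legSubstᵢ`, `triplePoly_legActᵢ`,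
`symTripleHw`, `finrank_symTripleHw`, `eq_zero_of_triplePoly_eq_zero`, `eq_of_triplePoly_eq`),
`KroneckerSemigroup` (`tripleHw`, `legActᵢ_eq_smul_of_mem_tripleHw`), `KroneckerPointSets`
(`wordContent_eq_of_mem_tripleHw_of_ne_zero`, `exists_pointSet_rows_of_kroneckerCoeff_pos`,
`kroneckerCoeff_pos_of_getD_add`, `kroneckerCoeff_pos_of_size_zero`, `getD_sortedParts_transpose`),
`OccurrenceObstructionsBIP/IP/IPHookPositivity` (`partitionOfRows`, `getD_sortedParts_rectangle`,
`sortedParts_rectangle`), `SymmetricGroupCharacterEvaluation` (`kroneckerCoeff_pos_iff_kronSum_pos`),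
`MS08SeparabilityProofs` (`MS08_prop_12_5_of_BLMW2011_prop_8_1`). Mathlib: `Matrix.transvection`,
`Matrix.det_transvection_of_ne`, `MvPolynomial.rename_injective`, `MvPolynomial.algHom_ext`,
`MvPolynomial.IsWeightedHomogeneous.prod`, `finrank_span_singleton`, `Submodule.finrank_mono`,
`Finset.card_le_card_of_injOn`, `YoungDiagram.length_rowLens`.
-/

noncomputable section

open scoped BigOperators
open Matrix MvPolynomial

namespace Literature.Computability.AlgebraicComplexity

namespace RectangleTwoKronecker

open Literature.NumberTheory.DiophantineGeometry
open Literature.RepresentationTheory.ClassicalInvariants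
open Literature.RepresentationTheory.ClassicalInvariants.TwoByTwoTuple (Idx M2 subst₁ subst₂ shear₃ colWt)
open Literature.RepresentationTheory.ClassicalInvariants.TwoRowSl2 (Var shear rowWt rowSubst)

variable {k : Type*} [Field k]

/-! ### §1 Transvections in `GL₄` (the unipotent generators of the three Borel subgroups) -/

section Transvection

variable {σ : Type*} [Fintype σ] [LinearOrder σ]

omit [Fintype σ] in
/-- Entries of the transvection `1 + t E_{ab}`: `δ_{xy} + t δ_{xa} δ_{yb}` (plumbing). [folklore] -/
private theorem transvection_apply' (a b : σ) (t : k) (x y : σ) :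
    Matrix.transvection a b t x y = (if x = y then 1 else 0) + (if a = x ∧ b = y then t else 0) := by
  rw [Matrix.transvection, Matrix.add_apply, Matrix.one_apply, Matrix.single_apply]

/-- The transvection `1 + t E_{ab}`, `a ≠ b`, as an element of `GL σ k` (plumbing def). [folklore] -/
private def transvGL {a b : σ} (h : a ≠ b) (t : k) : GL σ k :=
  Matrix.GeneralLinearGroup.mkOfDetNeZero (Matrix.transvection a b t)
    (by rw [Matrix.det_transvection_of_ne a b h]; exact one_ne_zero)

/-- Its matrix (plumbing). [folklore] -/
private theorem coe_transvGL {a b : σ} (h : a ≠ b) (t : k) :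
    ((transvGL h t : GL σ k) : Matrix σ σ k) = Matrix.transvection a b t := rfl

/-- For `a < b` the transvection is upper triangular. [cite: FultonHarrisGTM129, §15.1] -/
private theorem isUpperTriangular_transvGL {a b : σ} (h : a < b) (t : k) :
    IsUpperTriangular (transvGL h.ne t : GL σ k) := by
  intro x y hyx
  change y < x at hyx
  rw [coe_transvGL, transvection_apply', if_neg hyx.ne', if_neg, add_zero]
  rintro ⟨rfl, rfl⟩
  exact lt_asymm h hyx

/-- Every weight character is `1` on a transvection. [cite: FultonHarrisGTM129, §15.1] -/
private theorem weightChar_transvGL (χ : Weight σ) {a b : σ} (h : a ≠ b) (t : k) :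
    weightChar χ (transvGL (k := k) h t) = (1 : k) := by
  rw [weightChar, coe_transvGL]
  refine Finset.prod_eq_one fun i _ => ?_
  rw [transvection_apply', if_pos rfl, if_neg, add_zero, _root_.one_zpow]
  rintro ⟨rfl, rfl⟩
  exact h rfl

end Transvection

/-! ### §2 The restriction of the polynomial of a triple tensor to the `2 × 2` blocks -/

section Restrict

/-- `2 ≤ 4` (plumbing). [folklore] -/
private theorem two_le_four : 2 ≤ 4 := by norm_num

/-- The embedding of the `2 × 2 × 4` variables into the `4 × 4 × 4` variables of the tree's model
(plumbing def). [folklore] -/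
def ι : Idx → Alpha 4 := fun v => ((Fin.castLE two_le_four v.1.1, Fin.castLE two_le_four v.1.2), v.2)

/-- `ι` is injective. [folklore] -/
theorem ι_injective : Function.Injective ι := by
  rintro ⟨⟨l, i⟩, j⟩ ⟨⟨l', i'⟩, j'⟩ h
  simp only [ι, Prod.mk.injEq, Fin.castLE_inj] at h
  obtain ⟨⟨rfl, rfl⟩, rfl⟩ := h
  rfl

/-- The restriction `X_{((l,i),j)} ↦ X_{((l,i),j)}` if `l, i < 2`, `↦ 0` otherwise (plumbing def).
[folklore] -/
def κ : MvPolynomial (Alpha 4) k →ₐ[k] MvPolynomial Idx k :=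
  aeval fun x => if h : (x.1.1 : ℕ) < 2 ∧ (x.1.2 : ℕ) < 2 then
    X ((⟨x.1.1, h.1⟩, ⟨x.1.2, h.2⟩), x.2) else 0

/-- `κ (X (ι v)) = X v`. [folklore] -/
@[simp] theorem κ_X_ι (v : Idx) : κ (k := k) (X (ι v)) = X v := by
  obtain ⟨⟨l, i⟩, j⟩ := v
  rw [κ, aeval_X, dif_pos ⟨l.2, i.2⟩]
  rfl

/-- First-leg reading of the variables: `((l,i),j) ↦ (l,(i,j))` (plumbing def). [folklore] -/
def e₁ : Idx ≃ Var (Fin 2 × Fin 4) where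
  toFun v := (v.1.1, (v.1.2, v.2))
  invFun u := ((u.1, u.2.1), u.2.2)
  left_inv _ := rfl
  right_inv _ := rfl

/-- Second-leg reading of the variables: `((l,i),j) ↦ (i,(l,j))` (plumbing def). [folklore] -/
def e₂ : Idx ≃ Var (Fin 2 × Fin 4) where
  toFun v := (v.1.2, (v.1.1, v.2))
  invFun u := ((u.2.1, u.1), u.2.2)
  left_inv _ := rfl
  right_inv _ := rfl

/-- Transport of a substitution along a renaming, from its action on variables (plumbing).
[folklore] -/
private theorem transport {σ τ : Type*} (f : σ → τ) (S : MvPolynomial σ k →ₐ[k] MvPolynomial σ k)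
    (T : MvPolynomial τ k →ₐ[k] MvPolynomial τ k) (h : ∀ v, T (X (f v)) = rename f (S (X v)))
    (Q : MvPolynomial σ k) : T (rename f Q) = rename f (S Q) := by
  have : T.comp (rename f) = (rename f).comp S :=
    MvPolynomial.algHom_ext fun v => by simpa using h v
  exact congrArg (fun φ : MvPolynomial σ k →ₐ[k] MvPolynomial τ k => φ Q) this

/-- If `T` fixes `rename f Q` and `T ∘ rename f = rename f ∘ S` on variables (`f` injective), then
`S` fixes `Q` (plumbing). [folklore] -/
private theorem eq_of_transport {σ τ : Type*} {f : σ → τ} (hf : Function.Injective f)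
    {S : MvPolynomial σ k →ₐ[k] MvPolynomial σ k} {T : MvPolynomial τ k →ₐ[k] MvPolynomial τ k}
    (h : ∀ v, T (X (f v)) = rename f (S (X v))) {Q : MvPolynomial σ k}
    (hQ : T (rename f Q) = rename f Q) : S Q = Q :=
  rename_injective f hf (by rw [← transport f S T h Q, hQ])

/-- **Images of triple-tensor polynomials under variable-to-variable maps are multihomogeneous**:
if on every word in the support of `M` the algebra map `Φ` sends the letters' variables to variables
of total weight `d`, then `Φ(P_M)` is `w`-homogeneous of degree `d`. [cite: FultonHarrisGTM129, §15.3] -/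
theorem map_triplePoly_mem_weightedHomogeneousSubmodule {N n : ℕ} {σ : Type*}
    (Φ : MvPolynomial (Alpha N) k →ₐ[k] MvPolynomial σ k) (w : σ → ℕ) (d : ℕ) (M : Word3 N n → k)
    (h : ∀ t, M t ≠ 0 → ∃ u : Fin n → σ, (∀ p, Φ (X (zip3 t p)) = X (u p)) ∧ ∑ p, w (u p) = d) :
    Φ (triplePoly M) ∈ weightedHomogeneousSubmodule k w d := by
  rw [triplePoly_eq_sum, map_sum]
  refine Submodule.sum_mem _ fun t _ => ?_
  by_cases ht : M t = 0
  · rw [ht, map_zero, zero_mul, map_zero]; exact Submodule.zero_mem _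
  · obtain ⟨u, hu, hd⟩ := h t ht
    have hprod : Φ (∏ p, X (zip3 t p)) = ∏ p, X (u p) := by
      rw [map_prod]; exact Finset.prod_congr rfl fun p _ => hu p
    rw [map_mul, hprod, MvPolynomial.algHom_C, MvPolynomial.algebraMap_eq, ← smul_eq_C_mul, ← hd]
    exact Submodule.smul_mem _ _ ((mem_weightedHomogeneousSubmodule _ _ _ _).2
      (IsWeightedHomogeneous.prod Finset.univ (fun p => (X (u p) : MvPolynomial σ k))
        (fun p => w (u p)) fun p _ => isWeightedHomogeneous_X k w (u p)))

end Restrict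

/-! ### §3 The semi-invariant polynomial `Q_M` of a triple tensor `M ∈ HW_{(δ,δ)} ⊗ HW_{(δ,δ)} ⊗ HW_π` -/

section Model

open Literature.Computability.Complexity (getD_sortedParts_rectangle)

variable [CharZero k] {n δ : ℕ}

/-- The weight `(δ, δ, 0, 0)` of `GL₄` (the rectangle `(δ, δ)`; plumbing def). [folklore] -/
def χrect (δ : ℕ) : Weight (Fin 4) := Weight.ofPartition 4 (Nat.Partition.rectangle 2 δ)

/-- `χrect δ = (δ, δ, 0, 0)`. [folklore] -/
theorem χrect_apply (δ : ℕ) (i : Fin 4) : χrect δ i = if (i : ℕ) < 2 then (δ : ℤ) else 0 := by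
  rw [χrect, Weight.ofPartition_apply, getD_sortedParts_rectangle]
  split_ifs <;> simp

/-- A letter carried by a word has positive content. [folklore] -/
private theorem wordContent_pos {N m : ℕ} (w : Word N m) (p : Fin m) : 0 < wordContent w (w p) :=
  Finset.card_pos.2 ⟨p, by simp⟩

/-- **Support**: a triple tensor with first two legs of weight `(δ, δ, 0, 0)` is supported on words
whose first two components use the letters `0, 1` only. [cite: IkenmeyerMulmuleyWalter2017, Lemma 2.2] -/
theorem letters_lt_two {χ₃ : Weight (Fin 4)} {M : Word3 4 n → k}
    (hM : M ∈ tripleHw k 4 n (χrect δ) (χrect δ) χ₃) {t : Word3 4 n} (ht : M t ≠ 0) (p : Fin n) :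
    (t.1.1 p : ℕ) < 2 ∧ (t.1.2 p : ℕ) < 2 := by
  constructor
  · by_contra hp
    have h := (wordContent_eq_of_mem_tripleHw_of_ne_zero k hM ht (t.1.1 p)).1
    rw [χrect_apply, if_neg hp, Nat.cast_eq_zero] at h
    exact (wordContent_pos t.1.1 p).ne' h
  · by_contra hp
    have h := (wordContent_eq_of_mem_tripleHw_of_ne_zero k hM ht (t.1.2 p)).2.1
    rw [χrect_apply, if_neg hp, Nat.cast_eq_zero] at h
    exact (wordContent_pos t.1.2 p).ne' h

/-- The `2 × 2 × 4`-reading of a supported word (plumbing def). [folklore] -/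
private def rd (t : Word3 4 n) (h : ∀ p, (t.1.1 p : ℕ) < 2 ∧ (t.1.2 p : ℕ) < 2) (p : Fin n) : Idx :=
  ((⟨t.1.1 p, (h p).1⟩, ⟨t.1.2 p, (h p).2⟩), t.2 p)

omit [CharZero k] in
/-- `κ` sends the variables of a supported word to the variables of its reading. [folklore] -/
private theorem κ_X_zip3 (t : Word3 4 n) (h : ∀ p, (t.1.1 p : ℕ) < 2 ∧ (t.1.2 p : ℕ) < 2) (p : Fin n) :
    κ (k := k) (X (zip3 t p)) = X (rd t h p) := by
  change κ (k := k) (X (((t.1.1 p, t.1.2 p), t.2 p))) = _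
  rw [κ, aeval_X, dif_pos (h p)]
  rfl

omit [CharZero k] in
/-- `ι` of the reading is the original letter triple. [folklore] -/
private theorem ι_rd (t : Word3 4 n) (h : ∀ p, (t.1.1 p : ℕ) < 2 ∧ (t.1.2 p : ℕ) < 2) (p : Fin n) :
    ι (rd t h p) = zip3 t p := by
  simp only [ι, rd]
  rfl

omit [CharZero k] in
/-- An algebra endomorphism fixing the variables of the support fixes `P_M` (plumbing). [folklore] -/
private theorem map_triplePoly_eq_self {N m : ℕ} (Φ : MvPolynomial (Alpha N) k →ₐ[k] MvPolynomial (Alpha N) k)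
    (M : Word3 N m → k) (h : ∀ t, M t ≠ 0 → ∀ p, Φ (X (zip3 t p)) = X (zip3 t p)) :
    Φ (triplePoly M) = triplePoly M := by
  rw [triplePoly_eq_sum, map_sum]
  refine Finset.sum_congr rfl fun t _ => ?_
  by_cases ht : M t = 0
  · rw [ht, map_zero, zero_mul, map_zero]
  · rw [map_mul, MvPolynomial.algHom_C, MvPolynomial.algebraMap_eq, map_prod]
    congr 1
    exact Finset.prod_congr rfl fun p _ => h t ht p

/-- **`P_M` lives on the `2 × 2` blocks**: `rename ι (κ P_M) = P_M`. [cite: BurgisserEtAl2011, §8.3 Prop. 8.1] -/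
theorem rename_ι_κ_triplePoly {χ₃ : Weight (Fin 4)} {M : Word3 4 n → k}
    (hM : M ∈ tripleHw k 4 n (χrect δ) (χrect δ) χ₃) :
    rename ι (κ (triplePoly M)) = triplePoly M := by
  have := map_triplePoly_eq_self ((rename ι).comp κ) M fun t ht p => by
    rw [AlgHom.comp_apply, κ_X_zip3 t (letters_lt_two hM ht), rename_X, ι_rd]
  simpa using this

omit [CharZero k] in
/-- The three Borel unipotents act trivially on `P_M` (leg 1). [cite: FultonHarrisGTM129, §15.3] -/
theorem legSubst₁_transvection {N m : ℕ} {χ₁ χ₂ χ₃ : Weight (Fin N)} {M : Word3 N m → k}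
    (hM : M ∈ tripleHw k N m χ₁ χ₂ χ₃) {a b : Fin N} (hab : a < b) (t : k) :
    legSubst₁ N (Matrix.transvection a b t) (triplePoly M) = triplePoly M := by
  have h := triplePoly_legAct₁ (transvGL hab.ne t) M
  rw [coe_transvGL] at h
  rw [← h, legAct₁_eq_smul_of_mem_tripleHw hM (isUpperTriangular_transvGL hab t),
    weightChar_transvGL, one_smul]

omit [CharZero k] in
/-- Leg 2. [cite: FultonHarrisGTM129, §15.3] -/
theorem legSubst₂_transvection {N m : ℕ} {χ₁ χ₂ χ₃ : Weight (Fin N)} {M : Word3 N m → k}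
    (hM : M ∈ tripleHw k N m χ₁ χ₂ χ₃) {a b : Fin N} (hab : a < b) (t : k) :
    legSubst₂ N (Matrix.transvection a b t) (triplePoly M) = triplePoly M := by
  have h := triplePoly_legAct₂ (transvGL hab.ne t) M
  rw [coe_transvGL] at h
  rw [← h, legAct₂_eq_smul_of_mem_tripleHw hM (isUpperTriangular_transvGL hab t),
    weightChar_transvGL, one_smul]

omit [CharZero k] in
/-- Leg 3. [cite: FultonHarrisGTM129, §15.3] -/
theorem legSubst₃_transvection {N m : ℕ} {χ₁ χ₂ χ₃ : Weight (Fin N)} {M : Word3 N m → k}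
    (hM : M ∈ tripleHw k N m χ₁ χ₂ χ₃) {a b : Fin N} (hab : a < b) (t : k) :
    legSubst₃ N (Matrix.transvection a b t) (triplePoly M) = triplePoly M := by
  have h := triplePoly_legAct₃ (transvGL hab.ne t) M
  rw [coe_transvGL] at h
  rw [← h, legAct₃_eq_smul_of_mem_tripleHw hM (isUpperTriangular_transvGL hab t),
    weightChar_transvGL, one_smul]

omit [CharZero k] in
/-- A sum over `Fin 4` against the transvection column (plumbing). [folklore] -/
private theorem sum_transvection_smul {V : Type*} [AddCommMonoid V] [Module k V] (a b y : Fin 4) (t : k)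
    (F : Fin 4 → V) :
    ∑ j : Fin 4, Matrix.transvection a b t j y • F j = F y + if y = b then t • F a else 0 := by
  simp only [transvection_apply', add_smul, Finset.sum_add_distrib, ite_smul, one_smul, zero_smul,
    Finset.sum_ite_eq', Finset.mem_univ, if_true]
  congr 1
  by_cases hy : y = b
  · subst hy
    simp
  · rw [if_neg hy]
    exact Finset.sum_eq_zero fun j _ => by rw [if_neg]; rintro ⟨-, h⟩; exact hy h.symm

omit [CharZero k] in
/-- Variable check, leg 3: the column shear. [folklore] -/
private theorem vc₃ (a b : Fin 4) (t : k) (v : Idx) :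
    legSubst₃ 4 (Matrix.transvection a b t) (X (ι v)) = rename ι (shear₃ a b t (X v)) := by
  rw [legSubst₃_X, sum_transvection_smul, shear₃, bind₁_X_right]
  obtain ⟨li, j⟩ := v
  by_cases hj : j = b
  · subst hj
    simp [ι, smul_eq_C_mul]
  · simp [ι, hj]

omit [CharZero k] in
/-- `(1 : Fin 4) = castLE l ↔ l = 1` for `l : Fin 2` (plumbing). [folklore] -/
private theorem castLE_eq_one_iff (l : Fin 2) : Fin.castLE two_le_four l = 1 ↔ l = 1 := by
  fin_cases l <;> decide

omit [CharZero k] in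
/-- Variable check, leg 1: the row shear of `TwoRowSl2` read through `e₁`. [folklore] -/
private theorem vc₁ (t : k) (u : Var (Fin 2 × Fin 4)) :
    legSubst₁ 4 (Matrix.transvection 0 1 t) (X ((ι ∘ e₁.symm) u)) =
      rename (ι ∘ e₁.symm) (shear 0 1 t (X u)) := by
  obtain ⟨l, i, j⟩ := u
  rw [legSubst₁_X, sum_transvection_smul, shear, aeval_X]
  by_cases hl : l = 1
  · subst hl
    simp [ι, e₁, smul_eq_C_mul]
  · have : Fin.castLE two_le_four l ≠ 1 := fun h => hl ((castLE_eq_one_iff l).1 h)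
    simp [ι, e₁, hl, this]

omit [CharZero k] in
/-- Variable check, leg 2. [folklore] -/
private theorem vc₂ (t : k) (u : Var (Fin 2 × Fin 4)) :
    legSubst₂ 4 (Matrix.transvection 0 1 t) (X ((ι ∘ e₂.symm) u)) =
      rename (ι ∘ e₂.symm) (shear 0 1 t (X u)) := by
  obtain ⟨l, i, j⟩ := u
  rw [legSubst₂_X, sum_transvection_smul, shear, aeval_X]
  by_cases hl : l = 1
  · subst hl
    simp [ι, e₂, smul_eq_C_mul]
  · have : Fin.castLE two_le_four l ≠ 1 := fun h => hl ((castLE_eq_one_iff l).1 h)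
    simp [ι, e₂, hl, this]

omit [CharZero k] in
/-- Variable check: `subst₁` read through `e₁` is `rowSubst`. [folklore] -/
private theorem vc₁' (g : M2 k) (v : Idx) : rowSubst g (X (e₁ v)) = rename e₁ (subst₁ g (X v)) := by
  obtain ⟨⟨l, i⟩, j⟩ := v
  simp [rowSubst, subst₁, e₁, Fin.sum_univ_two, smul_eq_C_mul]

omit [CharZero k] in
/-- Variable check: `subst₂` read through `e₂` is `rowSubst`. [folklore] -/
private theorem vc₂' (g : M2 k) (v : Idx) : rowSubst g (X (e₂ v)) = rename e₂ (subst₂ g (X v)) := by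
  obtain ⟨⟨l, i⟩, j⟩ := v
  simp [rowSubst, subst₂, e₂, Fin.sum_univ_two, smul_eq_C_mul]

/-- A count of positions as a sum of indicators (plumbing). [folklore] -/
private theorem wordContent_eq_sum {N m : ℕ} (w : Word N m) (i : Fin N) :
    wordContent w i = ∑ p, if w p = i then 1 else 0 := by
  rw [wordContent, Finset.card_filter]

variable {π : Nat.Partition n} {M : Word3 4 n → k}

/-- **`h3`: column shears fix `Q_M`.** [cite: BurgisserEtAl2011, §8.3 Prop. 8.1] -/
theorem shear₃_κ (hM : M ∈ tripleHw k 4 n (χrect δ) (χrect δ) (Weight.ofPartition 4 π))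
    (a b : Fin 4) (hab : a < b) (t : k) : shear₃ a b t (κ (triplePoly M)) = κ (triplePoly M) :=
  eq_of_transport ι_injective (vc₃ a b t) (by
    rw [rename_ι_κ_triplePoly hM]; exact legSubst₃_transvection hM hab t)

/-- **`h4`: `Q_M` is multihomogeneous of multidegree `π`.** [cite: BurgisserEtAl2011, §8.3 Prop. 8.1] -/
theorem κ_mem_colWt (hM : M ∈ tripleHw k 4 n (χrect δ) (χrect δ) (Weight.ofPartition 4 π)) (j : Fin 4) :
    κ (triplePoly M) ∈ weightedHomogeneousSubmodule k (colWt j) (π.sortedParts.getD j 0) := by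
  refine map_triplePoly_mem_weightedHomogeneousSubmodule κ (colWt j) _ M fun t ht => ?_
  refine ⟨rd t (letters_lt_two hM ht), κ_X_zip3 t _, ?_⟩
  have h := (wordContent_eq_of_mem_tripleHw_of_ne_zero k hM ht j).2.2
  rw [Weight.ofPartition_apply, Nat.cast_inj] at h
  rw [← h, wordContent_eq_sum]
  rfl

/-- The first-leg reading `F₁ = rename e₁ Q_M` is fixed by the row shear. [cite: BurgisserEtAl2011, §8.3 Prop. 8.1] -/
theorem shear_rename_e₁ (hM : M ∈ tripleHw k 4 n (χrect δ) (χrect δ) (Weight.ofPartition 4 π)) (t : k) :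
    shear 0 1 t (rename e₁ (κ (triplePoly M))) = rename e₁ (κ (triplePoly M)) := by
  refine eq_of_transport (f := ι ∘ e₁.symm) (ι_injective.comp e₁.symm.injective) (vc₁ t) ?_
  have e : rename (ι ∘ ⇑e₁.symm) (rename e₁ (κ (k := k) (triplePoly M))) = rename ι (κ (triplePoly M)) := by
    rw [rename_rename]; rfl
  rw [e, rename_ι_κ_triplePoly hM]
  exact legSubst₁_transvection hM (by decide) t

/-- The second-leg reading `F₂ = rename e₂ Q_M` is fixed by the row shear. [cite: BurgisserEtAl2011, §8.3 Prop. 8.1] -/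
theorem shear_rename_e₂ (hM : M ∈ tripleHw k 4 n (χrect δ) (χrect δ) (Weight.ofPartition 4 π)) (t : k) :
    shear 0 1 t (rename e₂ (κ (triplePoly M))) = rename e₂ (κ (triplePoly M)) := by
  refine eq_of_transport (f := ι ∘ e₂.symm) (ι_injective.comp e₂.symm.injective) (vc₂ t) ?_
  have e : rename (ι ∘ ⇑e₂.symm) (rename e₂ (κ (k := k) (triplePoly M))) = rename ι (κ (triplePoly M)) := by
    rw [rename_rename]; rfl
  rw [e, rename_ι_κ_triplePoly hM]
  exact legSubst₂_transvection hM (by decide) t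

/-- `F₁` is bihomogeneous of bidegree `(δ, δ)` in the two rows. [cite: BurgisserEtAl2011, §8.3 Prop. 8.1] -/
theorem rename_e₁_mem_rowWt (hM : M ∈ tripleHw k 4 n (χrect δ) (χrect δ) (Weight.ofPartition 4 π))
    (l : Fin 2) : rename e₁ (κ (triplePoly M)) ∈ weightedHomogeneousSubmodule k (rowWt l) δ := by
  rw [← AlgHom.comp_apply]
  refine map_triplePoly_mem_weightedHomogeneousSubmodule _ (rowWt l) δ M fun t ht => ?_
  refine ⟨fun p => e₁ (rd t (letters_lt_two hM ht) p), fun p => by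
    rw [AlgHom.comp_apply, κ_X_zip3 t (letters_lt_two hM ht), rename_X], ?_⟩
  have h := (wordContent_eq_of_mem_tripleHw_of_ne_zero k hM ht (Fin.castLE two_le_four l)).1
  rw [χrect_apply, if_pos (by simpa using l.2), Nat.cast_inj] at h
  refine Eq.trans ?_ h
  rw [wordContent_eq_sum]
  refine Finset.sum_congr rfl fun p _ => ?_
  simp only [rowWt, e₁, rd, Equiv.coe_fn_mk, Fin.ext_iff, Fin.val_castLE]

/-- `F₂` is bihomogeneous of bidegree `(δ, δ)` in the two rows. [cite: BurgisserEtAl2011, §8.3 Prop. 8.1] -/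
theorem rename_e₂_mem_rowWt (hM : M ∈ tripleHw k 4 n (χrect δ) (χrect δ) (Weight.ofPartition 4 π))
    (l : Fin 2) : rename e₂ (κ (triplePoly M)) ∈ weightedHomogeneousSubmodule k (rowWt l) δ := by
  rw [← AlgHom.comp_apply]
  refine map_triplePoly_mem_weightedHomogeneousSubmodule _ (rowWt l) δ M fun t ht => ?_
  refine ⟨fun p => e₂ (rd t (letters_lt_two hM ht) p), fun p => by
    rw [AlgHom.comp_apply, κ_X_zip3 t (letters_lt_two hM ht), rename_X], ?_⟩
  have h := (wordContent_eq_of_mem_tripleHw_of_ne_zero k hM ht (Fin.castLE two_le_four l)).2.1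
  rw [χrect_apply, if_pos (by simpa using l.2), Nat.cast_inj] at h
  refine Eq.trans ?_ h
  rw [wordContent_eq_sum]
  refine Finset.sum_congr rfl fun p _ => ?_
  simp only [rowWt, e₂, rd, Equiv.coe_fn_mk, Fin.ext_iff, Fin.val_castLE]

/-- **`h1`: `Q_M` is fixed by `x_j ↦ g x_j`, `g ∈ SL₂`** — by `TwoRowSl2.rowSubst_eq_self_of_shear`
(a `U`-fixed form of bidegree `(δ, δ)` is `SL₂`-fixed). [cite: BurgisserEtAl2011, §8.3 Prop. 8.1] -/
theorem subst₁_κ (hM : M ∈ tripleHw k 4 n (χrect δ) (χrect δ) (Weight.ofPartition 4 π))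
    (g : M2 k) (hg : g.det = 1) : subst₁ g (κ (triplePoly M)) = κ (triplePoly M) :=
  eq_of_transport e₁.injective (vc₁' g)
    (TwoRowSl2.rowSubst_eq_self_of_shear (shear_rename_e₁ hM) (rename_e₁_mem_rowWt hM 0)
      (rename_e₁_mem_rowWt hM 1) g hg)

/-- **`h2`: `Q_M` is fixed by `x_j ↦ x_j g`, `g ∈ SL₂`.** [cite: BurgisserEtAl2011, §8.3 Prop. 8.1] -/
theorem subst₂_κ (hM : M ∈ tripleHw k 4 n (χrect δ) (χrect δ) (Weight.ofPartition 4 π))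
    (g : M2 k) (hg : g.det = 1) : subst₂ g (κ (triplePoly M)) = κ (triplePoly M) :=
  eq_of_transport e₂.injective (vc₂' g)
    (TwoRowSl2.rowSubst_eq_self_of_shear (shear_rename_e₂ hM) (rename_e₂_mem_rowWt hM 0)
      (rename_e₂_mem_rowWt hM 1) g hg)

end Model

/-! ### §4 Parity and multiplicity one for `(HW_{(δ,δ)} ⊗ HW_{(δ,δ)} ⊗ HW_π)^{S_n}` -/

section Space

variable [CharZero k] [IsAlgClosed k] {n δ : ℕ} {π : Nat.Partition n} {M M' : Word3 4 n → k}

omit [IsAlgClosed k] in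
/-- `Q_M ≠ 0` for a nonzero symmetric `M`. [cite: BurgisserEtAl2011, §8.3 Prop. 8.1] -/
theorem κ_triplePoly_ne_zero
    (hM : M ∈ symTripleHw k 4 n (χrect δ) (χrect δ) (Weight.ofPartition 4 π)) (h0 : M ≠ 0) :
    κ (triplePoly M) ≠ 0 := fun h =>
  h0 (eq_zero_of_triplePoly_eq_zero hM.2 (by rw [← rename_ι_κ_triplePoly hM.1, h, map_zero]))

/-- **Parity**: a nonzero `M` forces `π₀ ≡ π₁ ≡ π₂ ≡ π₃ (mod 2)` (Theorem A of
`TwoByTwoTupleSemiInvariants`). [cite: BurgisserEtAl2011, §8.3 Prop. 8.1] -/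
theorem getD_mod_two_eq
    (hM : M ∈ symTripleHw k 4 n (χrect δ) (χrect δ) (Weight.ofPartition 4 π)) (h0 : M ≠ 0)
    (j : Fin 4) : π.sortedParts.getD j 0 % 2 = π.sortedParts.getD 0 0 % 2 :=
  TwoByTwoTuple.parity_of_ne_zero (ρ := fun j : Fin 4 => π.sortedParts.getD j 0)
    (subst₁_κ hM.1) (subst₂_κ hM.1) (fun a b hab t => shear₃_κ hM.1 a b hab t) (κ_mem_colWt hM.1)
    (κ_triplePoly_ne_zero hM h0) j

/-- **Multiplicity one**: any two elements, one nonzero, are proportional (Theorem B of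
`TwoByTwoTupleSemiInvariants`). [cite: BurgisserEtAl2011, §8.3 Prop. 8.1] -/
theorem exists_eq_smul
    (hM : M ∈ symTripleHw k 4 n (χrect δ) (χrect δ) (Weight.ofPartition 4 π))
    (hM' : M' ∈ symTripleHw k 4 n (χrect δ) (χrect δ) (Weight.ofPartition 4 π)) (h0 : M ≠ 0) :
    ∃ c : k, M' = c • M := by
  obtain ⟨c, hc⟩ := TwoByTwoTuple.exists_smul_eq_of_semiInvariant
    (ρ := fun j : Fin 4 => π.sortedParts.getD j 0)
    (subst₁_κ hM.1) (subst₂_κ hM.1) (fun a b hab t => shear₃_κ hM.1 a b hab t) (κ_mem_colWt hM.1)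
    (subst₁_κ hM'.1) (subst₂_κ hM'.1) (fun a b hab t => shear₃_κ hM'.1 a b hab t)
    (κ_mem_colWt hM'.1) (κ_triplePoly_ne_zero hM h0)
  refine ⟨c, eq_of_triplePoly_eq hM'.2 (fun τ t => by simp only [Pi.smul_apply, hM.2 τ t]) ?_⟩
  rw [triplePoly_smul, ← rename_ι_κ_triplePoly hM'.1, hc, map_smul, rename_ι_κ_triplePoly hM.1]

/-- `dim (HW_{(δ,δ)} ⊗ HW_{(δ,δ)} ⊗ HW_π)^{S_n} ≤ 1`. [cite: BurgisserEtAl2011, §8.3 Prop. 8.1] -/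
theorem finrank_symTripleHw_le_one :
    Module.finrank k (symTripleHw k 4 n (χrect δ) (χrect δ) (Weight.ofPartition 4 π)) ≤ 1 := by
  by_cases h : ∃ M ∈ symTripleHw k 4 n (χrect δ) (χrect δ) (Weight.ofPartition 4 π), M ≠ 0
  · obtain ⟨M, hM, h0⟩ := h
    have hle : symTripleHw k 4 n (χrect δ) (χrect δ) (Weight.ofPartition 4 π) ≤ k ∙ M := by
      intro M' hM'
      obtain ⟨c, hc⟩ := exists_eq_smul hM hM' h0
      exact Submodule.mem_span_singleton.2 ⟨c, hc.symm⟩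
    exact (Submodule.finrank_mono hle).trans (finrank_span_singleton h0).le
  · push Not at h
    rw [(Submodule.eq_bot_iff _).2 h, finrank_bot]
    exact zero_le_one

end Space

/-! ### §5 The Kronecker coefficients `g((δ,δ),(δ,δ),π)`: length, multiplicity, parity -/

section Kronecker

open Literature.Combinatorics.Enumerative.Tomography
open Literature.Computability.Complexity (getD_sortedParts_rectangle card_parts_rectangle_le
  getD_sortedParts_eq_zero)

variable (k) [CharZero k]

/-- **Length at most four**: `g((δ,δ),(δ,δ),π) > 0 ⇒ ℓ(π) ≤ 4`. A positive coefficient gives an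
`n`-point SET in `ℕ³` with marginals `((δ,δ), (δ,δ), πᵀ)` (IMW Lemma 2.3, tree
`exists_pointSet_rows_of_kroneckerCoeff_pos`); its points have `x, y < 2`, so at most `4` of them lie at
height `z = 0`, and their number is `πᵀ₁ = ℓ(π)`. [cite: IkenmeyerMulmuleyWalter2017, Lemma 2.3 (upper bound)] -/
theorem card_parts_le_four_of_kroneckerCoeff_pos {δ : ℕ} {π : Nat.Partition (2 * δ)}
    (h : 0 < kroneckerCoeff k (Nat.Partition.rectangle 2 δ) (Nat.Partition.rectangle 2 δ) π) :
    π.parts.card ≤ 4 := by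
  rw [← π.transpose_transpose] at h
  obtain ⟨P, -, hx, hy, hz⟩ := exists_pointSet_rows_of_kroneckerCoeff_pos k h
  have hz0 : zMarginal P 0 = π.parts.card := by
    rw [hz 0, getD_sortedParts_transpose, ← YoungDiagram.length_rowLens, π.rowLens_youngDiagram,
      π.length_sortedParts]
  rw [← hz0, zMarginal]
  have hsub : ∀ p ∈ P.filter (fun p => p.2.2 = 0), (p.1, p.2.1) ∈ Finset.range 2 ×ˢ Finset.range 2 := by
    intro p hp
    rw [Finset.mem_filter] at hp
    rw [Finset.mem_product, Finset.mem_range, Finset.mem_range]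
    constructor
    · by_contra h1
      have hpos : 0 < xMarginal P p.1 := Finset.card_pos.2 ⟨p, by simp [hp.1]⟩
      rw [hx, getD_sortedParts_rectangle, if_neg h1] at hpos
      exact lt_irrefl 0 hpos
    · by_contra h1
      have hpos : 0 < yMarginal P p.2.1 := Finset.card_pos.2 ⟨p, by simp [hp.1]⟩
      rw [hy, getD_sortedParts_rectangle, if_neg h1] at hpos
      exact lt_irrefl 0 hpos
  have hinj : Set.InjOn (fun p : ℕ × ℕ × ℕ => (p.1, p.2.1)) ↑(P.filter (fun p => p.2.2 = 0)) := by
    rintro ⟨a, b, c⟩ hp ⟨a', b', c'⟩ hp' he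
    simp only [Finset.coe_filter, Set.mem_setOf_eq] at hp hp'
    simp only [Prod.mk.injEq] at he
    obtain ⟨rfl, rfl⟩ := he
    rw [hp.2, hp'.2]
  calc (P.filter (fun p => p.2.2 = 0)).card ≤ (Finset.range 2 ×ˢ Finset.range 2).card :=
        Finset.card_le_card_of_injOn _ hsub hinj
    _ = 4 := by simp

/-- `ℓ(π) > 4 ⇒ g((δ,δ),(δ,δ),π) = 0`. [cite: BurgisserEtAl2011, §8.3 Prop. 8.1] -/
theorem kroneckerCoeff_eq_zero_of_four_lt_card {δ : ℕ} {π : Nat.Partition (2 * δ)}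
    (h : 4 < π.parts.card) :
    kroneckerCoeff k (Nat.Partition.rectangle 2 δ) (Nat.Partition.rectangle 2 δ) π = 0 := by
  by_contra hne
  exact absurd (card_parts_le_four_of_kroneckerCoeff_pos k (Nat.pos_of_ne_zero hne)) (not_le.2 h)

/-- `(δ, δ)` has at most `4` parts (plumbing). [folklore] -/
private theorem card_parts_rectangle_two_le (δ : ℕ) : (Nat.Partition.rectangle 2 δ).parts.card ≤ 4 :=
  (card_parts_rectangle_le 2 δ).trans (by norm_num)

variable [IsAlgClosed k]

/-- **Multiplicity at most one**: `g((δ,δ),(δ,δ),π) ≤ 1` for every `π ⊢ 2δ` (over an algebraically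
closed field of characteristic zero). [cite: BurgisserEtAl2011, §8.3 Prop. 8.1] -/
theorem kroneckerCoeff_rectangle_two_le_one (δ : ℕ) (π : Nat.Partition (2 * δ)) :
    kroneckerCoeff k (Nat.Partition.rectangle 2 δ) (Nat.Partition.rectangle 2 δ) π ≤ 1 := by
  by_cases hπ : π.parts.card ≤ 4
  · rw [← finrank_symTripleHw (k := k) (N := 4) _ _ π (card_parts_rectangle_two_le δ)
      (card_parts_rectangle_two_le δ) hπ]
    exact finrank_symTripleHw_le_one
  · rw [kroneckerCoeff_eq_zero_of_four_lt_card k (not_le.1 hπ)]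
    exact zero_le_one

/-- **Parity of the rows**: if `g((δ,δ),(δ,δ),π) ≠ 0` then `π_j ≡ π_0 (mod 2)` for `j < 4`.
[cite: BurgisserEtAl2011, §8.3 Prop. 8.1] -/
theorem getD_mod_two_eq_of_kroneckerCoeff_ne_zero {δ : ℕ} {π : Nat.Partition (2 * δ)}
    (h : kroneckerCoeff k (Nat.Partition.rectangle 2 δ) (Nat.Partition.rectangle 2 δ) π ≠ 0)
    (j : Fin 4) : π.sortedParts.getD j 0 % 2 = π.sortedParts.getD 0 0 % 2 := by
  have hπ := card_parts_le_four_of_kroneckerCoeff_pos k (Nat.pos_of_ne_zero h)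
  have hfin := finrank_symTripleHw (k := k) (N := 4) _ _ π (card_parts_rectangle_two_le δ)
    (card_parts_rectangle_two_le δ) hπ
  obtain ⟨M, hM, h0⟩ : ∃ M ∈ symTripleHw k 4 (2 * δ) (χrect δ) (χrect δ) (Weight.ofPartition 4 π),
      M ≠ 0 := by
    by_contra hne
    push Not at hne
    apply h
    rw [← hfin]
    change Module.finrank k (symTripleHw k 4 (2 * δ) (χrect δ) (χrect δ) (Weight.ofPartition 4 π)) = 0
    rw [(Submodule.eq_bot_iff _).2 hne, finrank_bot]
  exact getD_mod_two_eq hM h0 j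

end Kronecker

/-! ### §6 Existence: the admissible `π` have `g((δ,δ),(δ,δ),π) > 0` (semigroup property) -/

section Positivity

open Literature.Computability.Complexity (getD_sortedParts_rectangle sortedParts_rectangle
  getD_sortedParts_eq_zero sum_range_getD_sortedParts_of_le partitionOfRows
  getD_sortedParts_partitionOfRows card_parts_partitionOfRows_le antitone_getD_sortedParts)
open Literature.RepresentationTheory.FiniteGroups.MNEval
  (kronSum kroneckerCoeff_pos_iff_kronSum_pos sort_coe_eq_of_pairwise)

/-- Sorted parts of `(c^m)` given as a list (plumbing). [folklore] -/
private theorem sortedParts_ofSums_replicate {N : ℕ} (m c : ℕ) (hc : 0 < c)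
    (hs : ((List.replicate m c : List ℕ) : Multiset ℕ).sum = N) :
    (Nat.Partition.ofSums N (List.replicate m c : Multiset ℕ) hs).sortedParts = List.replicate m c := by
  have hparts : (Nat.Partition.ofSums N (List.replicate m c : Multiset ℕ) hs).parts =
      (List.replicate m c : Multiset ℕ) := by
    rw [Nat.Partition.ofSums_parts, Multiset.filter_eq_self]
    intro x hx
    rw [Multiset.mem_coe, List.mem_replicate] at hx
    omega
  rw [Nat.Partition.sortedParts, hparts]
  exact sort_coe_eq_of_pairwise (List.pairwise_replicate.2 (Or.inr le_rfl))

/-- Rows of `(c^m)` (plumbing). [folklore] -/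
private theorem getD_replicate' (m c i : ℕ) : (List.replicate m c).getD i 0 = if i < m then c else 0 := by
  rw [List.getD_eq_getElem?_getD, List.getElem?_replicate]
  split_ifs <;> rfl

/-- **The five atoms** `((1,1),(1,1),(2))`, `((2,2),(2,2),(2,2))`, `((3,3),(3,3),(2,2,2))`,
`((4,4),(4,4),(2,2,2,2))`, `((2,2),(2,2),(1,1,1,1))` have positive Kronecker coefficient (each is `1`:
Manivel's generators of the algebra of `U`-invariants for `n = 2`), certified in the kernel by the
tree's Murnaghan–Nakayama evaluator. [cite: BurgisserEtAl2011, §8.3 (proof of Prop. 8.1)] -/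
private theorem atom_pos {m c e : ℕ}
    (h : (m = 1 ∧ c = 2 ∧ e = 1) ∨ (m = 2 ∧ c = 2 ∧ e = 2) ∨ (m = 3 ∧ c = 2 ∧ e = 3) ∨
      (m = 4 ∧ c = 2 ∧ e = 4) ∨ (m = 4 ∧ c = 1 ∧ e = 2))
    (hs : ((List.replicate m c : List ℕ) : Multiset ℕ).sum = 2 * e) :
    0 < kroneckerCoeff ℂ (Nat.Partition.rectangle 2 e) (Nat.Partition.rectangle 2 e)
      (Nat.Partition.ofSums (2 * e) (List.replicate m c : Multiset ℕ) hs) := by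
  rcases h with ⟨rfl, rfl, rfl⟩ | ⟨rfl, rfl, rfl⟩ | ⟨rfl, rfl, rfl⟩ | ⟨rfl, rfl, rfl⟩ | ⟨rfl, rfl, rfl⟩ <;>
  · rw [kroneckerCoeff_pos_iff_kronSum_pos, sortedParts_rectangle 2 _ (by norm_num),
      sortedParts_ofSums_replicate _ _ (by norm_num)]
    decide

/-- **Peeling**: subtracting `c` from the first `m` rows of `π ⊢ 2δ` (all `≥ c`, the other rows `0`,
`mc = 2e`) leaves a partition `π' ⊢ 2(δ - e)` with at most four parts and rows `π_j - c`.
[cite: BurgisserEtAl2011, §8.3 (proof of Prop. 8.1)] -/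
private theorem peel {δ : ℕ} (π : Nat.Partition (2 * δ)) (hcard : π.parts.card ≤ 4) (m c e : ℕ)
    (hm : m ≤ 4) (hmc : m * c = 2 * e) (hge : ∀ j, j < m → c ≤ π.sortedParts.getD j 0)
    (hzero : ∀ j, m ≤ j → π.sortedParts.getD j 0 = 0) :
    e ≤ δ ∧ ∃ π' : Nat.Partition (2 * (δ - e)), π'.parts.card ≤ 4 ∧
      ∀ j, π'.sortedParts.getD j 0 = π.sortedParts.getD j 0 - c := by
  have hS := sum_range_getD_sortedParts_of_le π hcard
  simp only [Finset.sum_range_succ, Finset.sum_range_zero, zero_add] at hS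
  have h0 := hge 0; have h1 := hge 1; have h2 := hge 2; have h3 := hge 3
  have z0 := hzero 0; have z1 := hzero 1; have z2 := hzero 2; have z3 := hzero 3
  have hanti : Antitone fun j => π.sortedParts.getD j 0 - c := fun a b hab =>
    Nat.sub_le_sub_right (antitone_getD_sortedParts π hab) c
  have hsum : ∑ j ∈ Finset.range 4, (π.sortedParts.getD j 0 - c) = 2 * (δ - e) := by
    simp only [Finset.sum_range_succ, Finset.sum_range_zero, zero_add]
    interval_cases m <;> omega
  refine ⟨by interval_cases m <;> omega, partitionOfRows (fun j => π.sortedParts.getD j 0 - c) 4 _,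
    card_parts_partitionOfRows_le hanti hsum, fun j => ?_⟩
  rw [getD_sortedParts_partitionOfRows hanti hsum]
  split_ifs with hj
  · rfl
  · rw [hzero j (by omega), Nat.zero_sub]

/-- **The semigroup step**: `g((δ',δ'),(δ',δ'),π') > 0` and a positive atom `((e,e),(e,e),A)` with
`π = π' + A` row-wise give `g((δ,δ),(δ,δ),π) > 0`, `δ = δ' + e`.
[cite: IkenmeyerPanova2017, §1.1 (the semigroup property)] -/
private theorem step {δ δ' e : ℕ} (hδ : 2 * δ = 2 * δ' + 2 * e) {π : Nat.Partition (2 * δ)}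
    {π' : Nat.Partition (2 * δ')} {A : Nat.Partition (2 * e)}
    (hrows : ∀ i, π.sortedParts.getD i 0 = π'.sortedParts.getD i 0 + A.sortedParts.getD i 0)
    (h' : 0 < kroneckerCoeff ℂ (Nat.Partition.rectangle 2 δ') (Nat.Partition.rectangle 2 δ') π')
    (hA : 0 < kroneckerCoeff ℂ (Nat.Partition.rectangle 2 e) (Nat.Partition.rectangle 2 e) A) :
    0 < kroneckerCoeff ℂ (Nat.Partition.rectangle 2 δ) (Nat.Partition.rectangle 2 δ) π := by
  have hrect : ∀ i, (Nat.Partition.rectangle 2 δ).sortedParts.getD i 0 =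
      (Nat.Partition.rectangle 2 δ').sortedParts.getD i 0 +
        (Nat.Partition.rectangle 2 e).sortedParts.getD i 0 := by
    intro i
    simp only [getD_sortedParts_rectangle]
    split_ifs <;> omega
  exact kroneckerCoeff_pos_of_getD_add ℂ hδ hrect hrect hrows h' hA

/-- **Existence**: if `π ⊢ 2δ` has at most four parts and its rows are all even, or it has exactly
four odd rows, then `g((δ,δ),(δ,δ),π) > 0` — by induction on `δ`, peeling the atom `(2^{ℓ(π)})` (even
case) or `(1,1,1,1)` (odd case). [cite: BurgisserEtAl2011, §8.3 Prop. 8.1] -/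
theorem kroneckerCoeff_rectangle_two_pos_of_rows :
    ∀ (δ : ℕ) (π : Nat.Partition (2 * δ)), π.parts.card ≤ 4 →
      ((∀ j, Even (π.sortedParts.getD j 0)) ∨
        (π.parts.card = 4 ∧ ∀ j, j < 4 → Odd (π.sortedParts.getD j 0))) →
      0 < kroneckerCoeff ℂ (Nat.Partition.rectangle 2 δ) (Nat.Partition.rectangle 2 δ) π := by
  intro δ
  refine Nat.strong_induction_on δ fun δ ih => ?_
  intro π hcard hcond
  rcases Nat.eq_zero_or_pos δ with rfl | hδ
  · exact kroneckerCoeff_pos_of_size_zero ℂ (by norm_num) _ _ _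
  -- the rows beyond the number of parts vanish, the parts are positive
  have hzero : ∀ j, π.parts.card ≤ j → π.sortedParts.getD j 0 = 0 := fun j hj =>
    getD_sortedParts_eq_zero π hj
  have hpos : ∀ j, j < π.parts.card → 0 < π.sortedParts.getD j 0 := by
    intro j hj
    rw [← Nat.Partition.length_sortedParts] at hj
    rw [List.getD_eq_getElem _ _ hj]
    exact π.pos_of_mem_sortedParts (List.getElem_mem hj)
  rcases hcond with hev | ⟨h4, hodd⟩
  · -- even case: peel `(2^m)`, `m = ℓ(π) ≥ 1`
    set m := π.parts.card with hm
    have hm1 : 1 ≤ m := by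
      by_contra h0
      have hparts : π.parts = 0 := Multiset.card_eq_zero.1 (by omega)
      have := π.parts_sum
      rw [hparts, Multiset.sum_zero] at this
      omega
    have hge : ∀ j, j < m → 2 ≤ π.sortedParts.getD j 0 := by
      intro j hj
      obtain ⟨a, ha⟩ := hev j
      have := hpos j hj
      omega
    obtain ⟨hle, π', hcard', hrows'⟩ := peel π hcard m 2 m hcard (by ring) hge (fun j hj => hzero j hj)
    have hs : ((List.replicate m 2 : List ℕ) : Multiset ℕ).sum = 2 * m := by
      simp [mul_comm]
    have hA := atom_pos (m := m) (c := 2) (e := m) (by omega) hs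
    have hih := ih (δ - m) (by omega) π' hcard' (Or.inl fun j => by
      rw [hrows']
      obtain ⟨a, ha⟩ := hev j
      exact ⟨a - 1, by omega⟩)
    have hrows : ∀ i, π.sortedParts.getD i 0 = π'.sortedParts.getD i 0 +
        (Nat.Partition.ofSums (2 * m) (List.replicate m 2 : Multiset ℕ) hs).sortedParts.getD i 0 := by
      intro i
      rw [hrows', sortedParts_ofSums_replicate _ _ (by norm_num), getD_replicate']
      split_ifs with hi
      · have := hge i hi; omega
      · rw [hzero i (by omega)]
    have h2 : 2 * δ = 2 * (δ - m) + 2 * m := by omega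
    exact step h2 hrows hih hA
  · -- odd case: peel `(1,1,1,1)`
    have hge : ∀ j, j < 4 → 1 ≤ π.sortedParts.getD j 0 := fun j hj => hpos j (by omega)
    obtain ⟨hle, π', hcard', hrows'⟩ := peel π hcard 4 1 2 le_rfl (by norm_num) hge
      (fun j hj => hzero j (by omega))
    have hs : ((List.replicate 4 1 : List ℕ) : Multiset ℕ).sum = 2 * 2 := by simp
    have hA := atom_pos (m := 4) (c := 1) (e := 2) (by norm_num) hs
    have hih := ih (δ - 2) (by omega) π' hcard' (Or.inl fun j => by
      rw [hrows']
      by_cases hj : j < 4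
      · obtain ⟨a, ha⟩ := hodd j hj
        exact ⟨a, by omega⟩
      · rw [hzero j (by omega)]
        exact ⟨0, rfl⟩)
    have hrows : ∀ i, π.sortedParts.getD i 0 = π'.sortedParts.getD i 0 +
        (Nat.Partition.ofSums (2 * 2) (List.replicate 4 1 : Multiset ℕ) hs).sortedParts.getD i 0 := by
      intro i
      rw [hrows', sortedParts_ofSums_replicate _ _ (by norm_num), getD_replicate']
      split_ifs with hi
      · have := hge i hi; omega
      · rw [hzero i (by omega)]
    have h2 : 2 * δ = 2 * (δ - 2) + 2 * 2 := by omega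
    exact step h2 hrows hih hA

end Positivity

/-! ### §7 Rows versus parts -/

section Rows

variable {N : ℕ}

/-- A row below the number of parts is a part (plumbing). [folklore] -/
private theorem getD_sortedParts_mem_parts (π : Nat.Partition N) {j : ℕ} (hj : j < π.parts.card) :
    π.sortedParts.getD j 0 ∈ π.parts := by
  rw [← Nat.Partition.length_sortedParts] at hj
  rw [List.getD_eq_getElem _ _ hj]
  exact (Multiset.mem_sort _).mp (List.getElem_mem hj)

/-- Every part is a row (plumbing). [folklore] -/
private theorem exists_getD_sortedParts_eq (π : Nat.Partition N) {x : ℕ} (hx : x ∈ π.parts) :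
    ∃ j, j < π.parts.card ∧ π.sortedParts.getD j 0 = x := by
  have hx' : x ∈ π.sortedParts := (Multiset.mem_sort _).mpr hx
  obtain ⟨j, hj, hjx⟩ := List.mem_iff_getElem.1 hx'
  refine ⟨j, by rwa [← Nat.Partition.length_sortedParts], ?_⟩
  rw [List.getD_eq_getElem _ _ hj, hjx]

end Rows

end RectangleTwoKronecker

/-! ### §8 The two named facts -/

section Facts

open RectangleTwoKronecker Literature.NumberTheory.DiophantineGeometry
open Literature.Computability.Complexity (getD_sortedParts_eq_zero)

/-- **BLMW 2011, Prop. 8.1 (after Manivel), PROVED**: `g((δ,δ),(δ,δ),π) ≠ 0` iff `π` is even of length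
`≤ 4` or odd of length exactly `4`, and then it equals `1`. Discharges the named fact
`BLMW2011_prop_8_1`. [cite: BurgisserEtAl2011, §8.3 Prop. 8.1] -/
theorem BLMW2011_prop_8_1_holds : BLMW2011_prop_8_1 := by
  intro δ π
  have key : kroneckerCoeff ℂ (Nat.Partition.rectangle 2 δ) (Nat.Partition.rectangle 2 δ) π ≠ 0 ↔
      ((∀ x ∈ π.parts, Even x) ∧ π.parts.card ≤ 4) ∨ ((∀ x ∈ π.parts, Odd x) ∧ π.parts.card = 4) := by
    constructor
    · intro h
      have hcard := card_parts_le_four_of_kroneckerCoeff_pos ℂ (Nat.pos_of_ne_zero h)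
      have hpar := getD_mod_two_eq_of_kroneckerCoeff_ne_zero ℂ h
      -- every part has the parity of the first row
      have hparts : ∀ x ∈ π.parts, x % 2 = π.sortedParts.getD 0 0 % 2 := by
        intro x hx
        obtain ⟨j, hj, rfl⟩ := exists_getD_sortedParts_eq π hx
        exact hpar ⟨j, by omega⟩
      by_cases h4 : π.parts.card = 4
      · rcases Nat.even_or_odd (π.sortedParts.getD 0 0) with he | ho
        · refine Or.inl ⟨fun x hx => ?_, hcard⟩
          rw [Nat.even_iff, hparts x hx]; exact Nat.even_iff.1 he
        · refine Or.inr ⟨fun x hx => ?_, h4⟩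
          rw [Nat.odd_iff, hparts x hx]; exact Nat.odd_iff.1 ho
      · have h3 : π.sortedParts.getD 3 0 = 0 := getD_sortedParts_eq_zero π (by omega)
        have h0 : π.sortedParts.getD 0 0 % 2 = 0 := by
          have := hpar ⟨3, by norm_num⟩
          change π.sortedParts.getD 3 0 % 2 = π.sortedParts.getD 0 0 % 2 at this
          omega
        refine Or.inl ⟨fun x hx => ?_, hcard⟩
        rw [Nat.even_iff, hparts x hx, h0]
    · rintro (⟨hev, hcard⟩ | ⟨hodd, hcard⟩)
      · refine (kroneckerCoeff_rectangle_two_pos_of_rows δ π hcard (Or.inl fun j => ?_)).ne'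
        by_cases hj : j < π.parts.card
        · exact hev _ (getD_sortedParts_mem_parts π hj)
        · rw [getD_sortedParts_eq_zero π (not_lt.1 hj)]; exact ⟨0, rfl⟩
      · refine (kroneckerCoeff_rectangle_two_pos_of_rows δ π hcard.le (Or.inr ⟨hcard, fun j hj => ?_⟩)).ne'
        exact hodd _ (getD_sortedParts_mem_parts π (by omega))
  refine ⟨key, fun h => le_antisymm (kroneckerCoeff_rectangle_two_le_one ℂ δ π) (Nat.pos_of_ne_zero h)⟩

/-- **Mulmuley–Sohoni GCT II, Prop. 12.5 (symmetric-group form), PROVED** — from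
`BLMW2011_prop_8_1_holds` through the tree's reduction `MS08_prop_12_5_of_BLMW2011_prop_8_1`.
Discharges the named fact `MS08_prop_12_5`. [cite: MulmuleySohoniGCT2SIAM2008, Prop. 12.5] -/
theorem MS08_prop_12_5_holds : MS08_prop_12_5 :=
  MS08_prop_12_5_of_BLMW2011_prop_8_1 BLMW2011_prop_8_1_holds

end Facts

end Literature.Computability.AlgebraicComplexity
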